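import Summits.QuantumFields.YangMills.Theorems.BalabanUVNodesK0SingleBondStarLoops
import Summits.QuantumFields.YangMills.Theorems.BalabanUVNodesN07Thm1CornerLevelZeroObstruction

/-!
# K0⁗ ROW P11 — the impulse response of Bałaban's (0.4) averaging to one twisted bond, part C: ★ THE IMPULSE RESPONSE (`Ū(c⋆)` within `4t∕L³` of `1`, all other `Ū(c) = 1`)

Cell `pub-ymgap`, seat `pub-ymgap-dag-n21-c` g7 (R134 (a) N21 NE7c s1; K0⁗ ROW P11 negative side; INBOX INTENT-2 of 2026-08-27 ≈07:40Z; dag-n07-e g7 l.17651 «NO STOP —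
19b uses ONLY the crude global bound … your sharp `dist1_avgFun_singleBond_le` is NEW and needed»).  Filed `--kind proof --supports stmt-QuantumFields-20289 --as helper`.
[15] = [Balaban1985Variational]; [I] = [Balaban1987RG1]; [III] = [Balaban1988Convergent]; [B7] = [Balaban1985Averaging].

THE SERIES (four modules, one namespace `…Theorems.K0AveragedSingleBondFloor`): (A) `…K0SingleBondWalks` — walk bookkeeping and «Ū = 1 by avoidance ∕ by locality»;
(B) `…K0SingleBondStarLoops` — the loop variables of [I] (0.4) at the one coarse bond `c⋆` the twisted fine bond crosses, and the printed `exp[mean log]` of a two-valued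
family; (C) `…K0SingleBondResponse` — THE IMPULSE RESPONSE of Bałaban's (0.4) averaging of record (`avOfRecord = blockAvg expMeanLogSU`) to ONE twisted fine bond:
`|Ū(c⋆) − 1| ≤ exp(−log(1−t)∕L^{d−1}) − 1 ≤ 4t∕L³`, `Ū(c) = 1` for every other coarse bond; (D) `…K0AveragedSingleBondFloor` — ★★ THE FLOOR OF RECORD for node00-def-P11's
FILE 8 v1.3 fact: `VariationalThm1RegSepPrinted F N B₃ a₀ a₁ → 2L² ≤ B₃` (every `N ≥ 2`, `a₀, a₁ > 0`), unconditionally (existence by dag-n07-e 19a's small-action boundary avoidance).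
HONEST FRAMING: kernel bookkeeping about the TREE's own averaging and one certificate about a TREE-typed fact; nothing of Bałaban asserted or refuted (print: `B₃ = B₃(d, L)`;
node00-def-K0a displays `2L² ≤ B₃`); K0⁗ neither discharged nor refuted; counts unmoved; no `def`, no `sorry`, no `instance`.

THIS MODULE (C).  §5 the carriers (`r_κ = 0`, `κ ≠ μ₀`) are a fraction `≤ 1∕L^{d−1}` of the index set `{0,…,L−1}^d × S_d × S_d` of (0.4) (`card_carriers_div_le`); hence
★ `dist1_avgFun_single_star_le`: `|Ū(c⋆) − 1| ≤ exp(−log(1−t)∕L^{d−1}) − 1`; the twisted bond issues from `B(y₁)` (`blockOf_eq_of_corner_coords`); and ★ `avgFun_single_eq_one_of_ne_star`: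
`Ū(c) = 1` for EVERY other coarse bond (locality off the bonds at `y₁`; the `μ₀`-coordinate of the loops at them; torus longer than `2L`).  §7 numerics:
`exp(−log(1−t)∕L³) − 1 ≤ 4t∕L³` for `t ≤ 1∕2`, `L ≥ 1`.  §7b the level-0 (R)-demand on the printed range is MET by (7)-v1.3 alone when `1 ≤ B₃`
(`plaqSmallOn_printedPlaqs_zero_of_dataSmall7P`, dag-n07-e's withdrawn INTENT-19c corollary, credited) and the every-`N` forms of dag-n07-e 19b's N = 2 certificates via
`exists_su_dist1_eq` (p505245): `not_variationalThm1RegSepMixed_of_two_le`, `not_variationalThm1RegSepOuter_of_two_le`, `variationalThm1RegSepMixed_degenerate_of_two_le`.  So one twisted fine bond of size `t` moves the coarse plaquettes of the averaged field by at most `16t∕L³` — the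
SHARP single-bond estimate dag-n07-e INTENT-19 (B)(6)∕(C)(r3) recorded as missing («only the crude 434L²t is in tree»).
DEPENDENCES (by name): parts A–B; `BlockAveraging.blockOf_eq_of_near_emb`, `emb_shift_apply`, Mathlib `Real.abs_exp_sub_one_le`,
`Real.one_sub_inv_le_log_of_pos`.
-/

noncomputable section

open scoped Matrix.Norms.L2Operator

namespace Summit.QuantumFields.YangMills.Theorems.K0AveragedSingleBondFloor

open Literature.MathematicalPhysics.QuantumFieldTheory.Balaban1983to89
open Literature.MathematicalPhysics.QuantumFieldTheory.Balaban1983to89.Node00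
open Literature.MathematicalPhysics.QuantumFieldTheory.Balaban1983to89.T4Continuum
open B15DeterminingSets BlockAveraging
open Literature.MathematicalPhysics.QuantumFieldTheory.Balaban1983to89.T3DescentFibreTower (holAt_one axialAvg_one avgFun_one
  expMeanLogSU_E_one loopHol_one small_one)
/-! ## §5  The averaged single-bond configuration: `Ū(c⋆)` within `exp(−log(1−t)∕L^{d−1}) − 1` of `1`, `Ū(c) = 1` for every other coarse bond -/
section Response

open ExpMeanLog (deltaSU expMeanLogSU deltaSU_pos)

variable {P : Params} {j : ℕ}

/-- **THE CARRIERS ARE A FRACTION `1/L^{d−1}` OF THE INDEX SET OF (0.4)**: the indices `(r, σ, σ′)` with `r_κ = 0` for all `κ ≠ μ₀` number at most `L·(d!)²` among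
`|Idx| = L^d·(d!)²`. [cite: Balaban1987RG1, (0.4) p.253 (bookkeeping)] -/
theorem card_carriers_div_le (μ0 : Fin P.d) :
    ((Finset.univ.filter (fun i : Idx P => ∀ κ, κ ≠ μ0 → ((i.1 κ : Fin P.L) : ℕ) = 0)).card : ℝ) / Fintype.card (Idx P)
      ≤ 1 / (P.L : ℝ) ^ (P.d - 1) := by
  classical
  set S := Finset.univ.filter (fun i : Idx P => ∀ κ, κ ≠ μ0 → ((i.1 κ : Fin P.L) : ℕ) = 0) with hS
  have hLpos : 0 < P.L := P.L_pos
  have hd : 1 ≤ P.d := P.hd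
  -- `S` lies in the image of `Fin L × Perm × Perm`
  let Φ : Fin P.L × Equiv.Perm (Fin P.d) × Equiv.Perm (Fin P.d) → Idx P :=
    fun a => (Function.update (fun _ => (⟨0, hLpos⟩ : Fin P.L)) μ0 a.1, a.2.1, a.2.2)
  have hsub : S ⊆ Finset.univ.image Φ := by
    intro i hi
    rw [hS, Finset.mem_filter] at hi
    refine Finset.mem_image.2 ⟨(i.1 μ0, i.2.1, i.2.2), Finset.mem_univ _, ?_⟩
    obtain ⟨r, σ, σ'⟩ := i
    refine Prod.ext ?_ rfl
    funext κ
    by_cases hκ : κ = μ0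
    · subst hκ; simp [Φ]
    · simp only [Φ, Function.update_of_ne hκ]
      exact (Fin.ext (hi.2 κ hκ).symm)
  have hcardS : (S.card : ℝ) ≤ P.L * (Fintype.card (Equiv.Perm (Fin P.d)) : ℝ) ^ 2 := by
    have h1 : S.card ≤ Fintype.card (Fin P.L × Equiv.Perm (Fin P.d) × Equiv.Perm (Fin P.d)) :=
      (Finset.card_le_card hsub).trans (Finset.card_image_le.trans (by rw [Finset.card_univ]))
    have h2 : (S.card : ℝ) ≤ Fintype.card (Fin P.L × Equiv.Perm (Fin P.d) × Equiv.Perm (Fin P.d)) := by exact_mod_cast h1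
    refine h2.trans (le_of_eq ?_)
    simp only [Fintype.card_prod, Fintype.card_fin]
    push_cast; ring
  have hcardI : (Fintype.card (Idx P) : ℝ) = (P.L : ℝ) ^ P.d * (Fintype.card (Equiv.Perm (Fin P.d)) : ℝ) ^ 2 := by
    simp only [Idx, Fintype.card_prod, Fintype.card_fun, Fintype.card_fin]
    push_cast; ring
  have hp : (0 : ℝ) < (Fintype.card (Equiv.Perm (Fin P.d)) : ℝ) ^ 2 := by positivity
  have hL : (0 : ℝ) < P.L := by exact_mod_cast hLpos
  rw [hcardI, div_le_div_iff₀ (by positivity) (by positivity), one_mul]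
  calc (S.card : ℝ) * (P.L : ℝ) ^ (P.d - 1) ≤ P.L * (Fintype.card (Equiv.Perm (Fin P.d)) : ℝ) ^ 2 * (P.L : ℝ) ^ (P.d - 1) := by gcongr
    _ = (P.L : ℝ) ^ P.d * (Fintype.card (Equiv.Perm (Fin P.d)) : ℝ) ^ 2 := by
        have : (P.L : ℝ) ^ P.d = P.L * (P.L : ℝ) ^ (P.d - 1) := by
          rw [← pow_succ']; congr 1; omega
        rw [this]; ring

variable {N : ℕ} [NeZero N]

/-- **★ THE IMPULSE RESPONSE AT `c⋆`: `|Ū(c⋆) − 1| ≤ exp(−log(1 − t)∕L^{d−1}) − 1`** for Bałaban's (0.4) averaging with the printed `exp[mean log]` on `SU(N)` and the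
single-bond configuration (`|g − 1| ≤ t < δ_N`, `t < 1`): a fraction `≤ 1/L^{d−1}` of the loop variables is `g`, the rest and the straight transporter are `1`.
[cite: Balaban1987RG1, (0.4) p.253 (bookkeeping)] -/
theorem dist1_avgFun_single_star_le (hper : 2 * P.L < P.sitesPerDir j) (hL : 3 ≤ P.L) {κ₁ μ0 : Fin P.d} (hκ₁ : κ₁ ≠ μ0)
    (y₁ : Site P (j + 1)) (x' : Site P j) (g : Matrix.specialUnitaryGroup (Fin N) ℂ)
    (hx0 : x' μ0 = emb y₁ μ0 + (((P.L - 1) / 2 : ℕ) : ZMod (P.sitesPerDir j)))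
    (hxκ : ∀ κ, κ ≠ μ0 → x' κ + (((P.L - 1) / 2 : ℕ) : ZMod (P.sitesPerDir j)) = emb y₁ κ)
    {t : ℝ} (hg : dist1 g ≤ t) (htδ : t < deltaSU (Fin N)) (ht1 : t < 1) :
    dist1 (avgFun expMeanLogSU (fun b : PBond P j => if b.src = x' ∧ b.dir = μ0 then g else 1) ⟨y₁, μ0⟩)
      ≤ Real.exp (1 / (P.L : ℝ) ^ (P.d - 1) * (-Real.log (1 - t))) - 1 := by
  classical
  set U : GaugeField P j (Matrix.specialUnitaryGroup (Fin N) ℂ) := fun b => if b.src = x' ∧ b.dir = μ0 then g else 1 with hU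
  set S := Finset.univ.filter (fun i : Idx P => ∀ κ, κ ≠ μ0 → ((i.1 κ : Fin P.L) : ℕ) = 0) with hS
  have hloop : ∀ i : Idx P, loopHol U ⟨y₁, μ0⟩ i = if (∀ κ, κ ≠ μ0 → ((i.1 κ : Fin P.L) : ℕ) = 0) then g else 1 :=
    fun i => loopHol_single_star hper hL hκ₁ y₁ x' g hx0 hxκ i
  have hsmall : Small expMeanLogSU U ⟨y₁, μ0⟩ := by
    intro i
    rw [hloop i]
    split_ifs
    · exact hg.trans_lt htδ
    · rw [GaugeGroup.dist1_one]; exact deltaSU_pos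
  have hav : avgFun expMeanLogSU U ⟨y₁, μ0⟩ = expMeanLogSU.avg (loopHol U ⟨y₁, μ0⟩) := by
    show corr expMeanLogSU U ⟨y₁, μ0⟩ * AveragingRT.axialAvg U ⟨y₁, μ0⟩ = _
    rw [axialAvg_single_star hper hL hκ₁ y₁ x' g hxκ, mul_one, corr, if_pos hsmall]
  rw [hav]
  have hb := dist1_avg_expMeanLogSU_le (loopHol U ⟨y₁, μ0⟩) S g
    (fun i hi => by rw [hloop i, if_neg]; rw [hS, Finset.mem_filter] at hi; exact fun h => hi ⟨Finset.mem_univ _, h⟩)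
    (fun i hi => Or.inr (by rw [hloop i, if_pos]; rw [hS, Finset.mem_filter] at hi; exact hi.2)) hg htδ ht1
  refine hb.trans ?_
  have hℓ0 : 0 ≤ -Real.log (1 - t) := by
    have ht0 : 0 ≤ t := (GaugeGroup.dist1_nonneg g).trans hg
    rw [neg_nonneg]; exact Real.log_nonpos (by linarith) (by linarith)
  exact sub_le_sub_right (Real.exp_le_exp.mpr (mul_le_mul_of_nonneg_right (card_carriers_div_le μ0) hℓ0)) 1

/-- The twisted bond issues from the block `B(y₁)` (its source is within `h` of the centre in every coordinate). [cite: Balaban1987RG1, (0.1) p.252 (bookkeeping)] -/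
theorem blockOf_eq_of_corner_coords (hj : j + 1 ≤ P.m + P.K) {μ0 : Fin P.d} (y₁ : Site P (j + 1)) (x' : Site P j)
    (hx0 : x' μ0 = emb y₁ μ0 + (((P.L - 1) / 2 : ℕ) : ZMod (P.sitesPerDir j)))
    (hxκ : ∀ κ, κ ≠ μ0 → x' κ + (((P.L - 1) / 2 : ℕ) : ZMod (P.sitesPerDir j)) = emb y₁ κ) : blockOf x' = y₁ := by
  set h : ℕ := (P.L - 1) / 2 with hh
  refine blockOf_eq_of_near_emb hj y₁ x' (fun κ => if κ = μ0 then (h : ℤ) else -(h : ℤ)) (fun ν => ?_) (fun ν => ?_)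
  · by_cases hν : ν = μ0
    · subst hν; rw [if_pos rfl, hx0, Int.cast_natCast]
    · rw [if_neg hν, ← hxκ ν hν, Int.cast_neg, Int.cast_natCast]; ring
  · by_cases hν : ν = μ0
    · rw [if_pos hν]; constructor <;> omega
    · rw [if_neg hν]; constructor <;> omega

/-- **`Ū(c) = 1` FOR EVERY COARSE BOND `c ≠ c⋆`** (small-loop average with `E(1,…,1) = 1`; standing range; torus longer than `2L`): off the `2·2d − 1` bonds at `y₁` by
locality, at them by the `μ₀`-coordinate of the loops (which stays `≤ emb y₁ _{μ₀} + h` or, for `⟨y₁ − e_{μ₀}, μ₀⟩`, runs from `emb y₁ _{μ₀} − L − h`), never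
reaching the bond's far end at `emb y₁ _{μ₀} + h + 1`. [cite: Balaban1987RG1, (0.4) p.253 (bookkeeping)] -/
theorem avgFun_single_eq_one_of_ne_star {G : Type*} [GaugeGroup G] (ℰ : LoopAverage G) (hE : ∀ n : ℕ, ℰ.E (fun _ : Fin (n + 1) => (1 : G)) = 1)
    (hj : j + 1 ≤ P.m + P.K) (hper : 2 * P.L < P.sitesPerDir j) {μ0 : Fin P.d} (y₁ : Site P (j + 1)) (x' : Site P j) (g : G)
    (hx0 : x' μ0 = emb y₁ μ0 + (((P.L - 1) / 2 : ℕ) : ZMod (P.sitesPerDir j)))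
    (hxκ : ∀ κ, κ ≠ μ0 → x' κ + (((P.L - 1) / 2 : ℕ) : ZMod (P.sitesPerDir j)) = emb y₁ κ)
    (c : PBond P (j + 1)) (hc : c ≠ ⟨y₁, μ0⟩) :
    avgFun ℰ (fun b : PBond P j => if b.src = x' ∧ b.dir = μ0 then g else 1) c = 1 := by
  set h : ℕ := (P.L - 1) / 2 with hh
  have hL2 : 2 * h + 1 = P.L := AveragingRT.two_mul_half_add_one P
  have hblk : blockOf x' = y₁ := blockOf_eq_of_corner_coords hj y₁ x' hx0 hxκ
  have hT : (x'.shift μ0) μ0 = emb y₁ μ0 + (h : ZMod (P.sitesPerDir j)) + 1 := by rw [Site.shift_apply, if_pos rfl, hx0]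
  by_cases hsrc : c.src = y₁
  · -- `c = ⟨y₁, dir⟩` with `dir ≠ μ₀`
    have hdir : c.dir ≠ μ0 := by
      intro hd; apply hc; cases c; simp only [PBond.mk.injEq]; exact ⟨hsrc, hd⟩
    refine avgFun_single_eq_one_of_coord ℰ hE c x' μ0 g μ0 (fun e he1 he2 heq => ?_)
    rw [if_neg hdir] at he2
    rw [hsrc, hT] at heq
    have hc' : (((e : ℤ) - h - 1 : ℤ) : ZMod (P.sitesPerDir j)) = 0 := by
      have := sub_eq_zero.mpr heq; push_cast at this ⊢; linear_combination this
    exact intCast_ne_zero_of_natAbs_lt (by omega) (by omega) hc'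
  · by_cases htgt : c.tgt = y₁
    · -- `c.src = y₁ − e_{dir}`
      have hemb : ∀ ν, emb y₁ ν = emb c.src ν + (if ν = c.dir then (P.L : ZMod (P.sitesPerDir j)) else 0) := by
        intro ν; rw [← htgt]; exact emb_shift_apply c.src c.dir ν
      refine avgFun_single_eq_one_of_coord ℰ hE c x' μ0 g μ0 (fun e he1 he2 heq => ?_)
      rw [hT, hemb μ0] at heq
      by_cases hdir : c.dir = μ0
      · rw [if_pos hdir] at he2
        rw [if_pos hdir.symm] at heq
        have hc' : (((e : ℤ) - (2 * h + 1 : ℕ) - h - 1 : ℤ) : ZMod (P.sitesPerDir j)) = 0 := by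
          rw [hL2]
          have := sub_eq_zero.mpr heq; push_cast at this ⊢; linear_combination this
        refine intCast_ne_zero_of_natAbs_lt ?_ ?_ hc'
        · push_cast; omega
        · push_cast; omega
      · rw [if_neg hdir] at he2
        rw [if_neg (Ne.symm hdir), add_zero] at heq
        have hc' : (((e : ℤ) - h - 1 : ℤ) : ZMod (P.sitesPerDir j)) = 0 := by
          have := sub_eq_zero.mpr heq; push_cast at this ⊢; linear_combination this
        exact intCast_ne_zero_of_natAbs_lt (by omega) (by omega) hc'
    · exact avgFun_single_eq_one_of_blockOf_ne ℰ hE hj c x' μ0 g (by rw [hblk]; exact Ne.symm hsrc) (by rw [hblk]; exact Ne.symm htgt)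

end Response

/-! ## §7  Numerics: `exp(−log(1−t)∕L³) − 1 ≤ 4t∕L³` for `t ≤ 1∕2`, `L ≥ 1` -/
section Numerics

/-- `exp(−log(1 − t)∕L³) − 1 ≤ 4t∕L³` for `0 ≤ t ≤ 1∕2`, `L ≥ 1` (`−log(1−t) ≤ t∕(1−t) ≤ 2t`, `e^a − 1 ≤ 2a` on `[0, 1]`). [folklore] -/
theorem exp_log_ratio_le {t L : ℝ} (ht0 : 0 ≤ t) (ht : t ≤ 1 / 2) (hL : 1 ≤ L) :
    Real.exp (1 / L ^ 3 * (-Real.log (1 - t))) - 1 ≤ 4 * t / L ^ 3 := by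
  have h1t : 0 < 1 - t := by linarith
  have hℓ : -Real.log (1 - t) ≤ 2 * t := by
    have h := Real.one_sub_inv_le_log_of_pos h1t
    have hinv : (1 - t)⁻¹ ≤ 1 + 2 * t := by
      rw [inv_eq_one_div, div_le_iff₀ h1t]
      nlinarith
    linarith
  have hℓ0 : 0 ≤ -Real.log (1 - t) := by
    rw [neg_nonneg]; exact Real.log_nonpos (by linarith) (by linarith)
  have hL3 : 1 ≤ L ^ 3 := one_le_pow₀ hL
  have hL3pos : 0 < L ^ 3 := by positivity
  set a : ℝ := 1 / L ^ 3 * (-Real.log (1 - t)) with ha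
  have ha0 : 0 ≤ a := by positivity
  have ha1 : a ≤ 2 * t / L ^ 3 := by
    rw [ha, div_mul_eq_mul_div, one_mul]
    exact div_le_div_of_nonneg_right hℓ hL3pos.le
  have ha1' : a ≤ 1 := by
    refine ha1.trans ?_
    rw [div_le_one hL3pos]; linarith
  have habs : |a| ≤ 1 := by rw [abs_of_nonneg ha0]; exact ha1'
  have h := Real.abs_exp_sub_one_le habs
  rw [abs_of_nonneg ha0] at h
  have h' : Real.exp a - 1 ≤ 2 * a := (le_abs_self _).trans h
  calc Real.exp a - 1 ≤ 2 * a := h'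
    _ ≤ 2 * (2 * t / L ^ 3) := by linarith
    _ = 4 * t / L ^ 3 := by ring

end Numerics

/-! ## §7b  The level-0 (R)-demand on the printed range from (7)-v1.3 alone; the every-`N` forms of dag-n07-e 19b's certificates -/
section Corollaries

open Summit.QuantumFields.YangMills.Theorems.K0VariationalThm1OuterRange (plaqHol_eq_of_agreeOn_of_mem_printedPlaqs_zero)
open Summit.QuantumFields.YangMills.Theorems.K0VariationalThm1DatumCoupling (exists_su_dist1_eq)
open Summit.QuantumFields.YangMills.BalabanUVNodes.N07Thm1CornerLevelZeroObstruction (not_variationalThm1RegSepMixed_of_dist1Surj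
  not_variationalThm1RegSepOuter_of_dist1Surj)

variable {P : Params} {G : Type*} [GaugeGroup G]

/-- **THE LEVEL-0 (R)-DEMAND ON THE PRINTED RANGE IS MET BY (7)-v1.3 ALONE when `1 ≤ B₃`** (`k ≥ 1`, `η₀ = 1`): every fibre element of a datum satisfying
`Sect2.DataSmall7P av Ω k δ W` is `B₃·δ₀`-small on `printedPlaqs Ω k 0` — these plaquettes are pinned to `W₀` (p510186) and (7) bounds `W₀` there by `δ₀ ≤ B₃δ₀`.  So the (M3)
channel is closed for ALL data, not only for the certificate's (dag-n07-e g7's withdrawn INTENT-19c corollary, INBOX l.17651 — credited). [cite: Balaban1985Variational, (7)–(8) pp.278–279 (bookkeeping)] -/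
theorem plaqSmallOn_printedPlaqs_zero_of_dataSmall7P (av : ∀ j, Averaging P j G) {Ω : ℕ → Set (Site P 0)} {k : ℕ} (hk : 0 < k) {δ : ℕ → ℝ}
    {W : MSField P G} (h7 : Sect2.DataSmall7P av Ω k δ W) {U₀ : GaugeField P 0 G} (hA : AgreeOn (genSet Ω k) (avgFamily av U₀) W) {B₃ : ℝ} (hB : 1 ≤ B₃)
    (hδ : 0 ≤ δ 0) : PlaqSmallOn (Sect2.printedPlaqs Ω k 0) (B₃ * δ 0 * P.eta 0 ^ 2) U₀ := by
  intro q hq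
  rw [plaqHol_eq_of_agreeOn_of_mem_printedPlaqs_zero av hk hA hq]
  refine (h7.1 q hq).trans_le ?_
  have h1 : P.eta 0 ^ 2 = 1 := by simp [Params.eta]
  rw [h1, mul_one]
  exact le_mul_of_one_le_left hδ hB

variable {F : T4Family} {N : ℕ} [NeZero N]

/-- **★★ `¬ VariationalThm1RegSepMixed F N B₃ a₀ a₁` FOR EVERY `N ≥ 2`**, every `B₃`, `0 < a₀`, `0 < a₁` — dag-n07-e 19b's certificate with its `hG` discharged by
`exists_su_dist1_eq` (p505245). [cite: Balaban1985Variational, Thm 1 (7)–(8) pp.278–279 (bookkeeping)] -/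
theorem not_variationalThm1RegSepMixed_of_two_le (hN : 2 ≤ N) {B₃ a₀ a₁ : ℝ} (ha₀ : 0 < a₀) (ha₁ : 0 < a₁) :
    ¬ VariationalThm1RegSepMixed F N B₃ a₀ a₁ :=
  not_variationalThm1RegSepMixed_of_dist1Surj F (fun _ h0 h2 => exists_su_dist1_eq hN h0 h2) ha₀ ha₁

/-- **★★ `¬ VariationalThm1RegSepOuter F N B₃ a₀ a₁` FOR EVERY `N ≥ 2`**, every `B₃`, `0 < a₀`, `0 < a₁`. [cite: Balaban1985Variational, Thm 1 (7)–(8) pp.278–279 (bookkeeping)] -/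
theorem not_variationalThm1RegSepOuter_of_two_le (hN : 2 ≤ N) {B₃ a₀ a₁ : ℝ} (ha₀ : 0 < a₀) (ha₁ : 0 < a₁) :
    ¬ VariationalThm1RegSepOuter F N B₃ a₀ a₁ :=
  not_variationalThm1RegSepOuter_of_dist1Surj F (fun _ h0 h2 => exists_su_dist1_eq hN h0 h2) ha₀ ha₁

/-- Truth set of FILE 8 v1.0's fact on every `SU(N)`, `N ≥ 2`: it holds only in the degenerate corner `a₀ ≤ 0 ∨ a₁ ≤ 0`. [cite: Balaban1985Variational, Thm 1 (7)–(8) pp.278–279 (bookkeeping)] -/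
theorem variationalThm1RegSepMixed_degenerate_of_two_le (hN : 2 ≤ N) {B₃ a₀ a₁ : ℝ} (h : VariationalThm1RegSepMixed F N B₃ a₀ a₁) : a₀ ≤ 0 ∨ a₁ ≤ 0 := by
  by_contra hne
  push Not at hne
  exact not_variationalThm1RegSepMixed_of_two_le hN hne.1 hne.2 h

end Corollaries

end Summit.QuantumFields.YangMills.Theorems.K0AveragedSingleBondFloor

end
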